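import Summits.HodgeConjecture.HodgeConjecture.Theorems.F0P3cU2PrincipalSeriesOpenCellTorusChar     -- ★-to-be p849556 (γ-W)₂ `torus_normalizedJacquet_openCellLine_eq_weylChar_two`
import Summits.HodgeConjecture.HodgeConjecture.Theorems.F0P3U3PrincipalSeriesJacquetFiltrationHolds  -- ★ B-p10 abstract `finrank_eq_two_of_closedCell_openCell`
import Summits.HodgeConjecture.HodgeConjecture.Theorems.F0P3U3PrincipalSeriesJacquetClosedCell       -- ★ A-p19 GENERIC `evalJacquetKer` (closed cell)
import Literature.NumberTheory.Automorphic.SmoothIndOpenCellCoinvariants                           -- ★ A-p19 GENERIC open-cell bound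
import Literature.NumberTheory.Automorphic.CMPrincipalSeriesJacquetEvalOne                          -- ★ B-p10 (L-q) GENERIC-`N`
import Literature.NumberTheory.Automorphic.CMPrincipalSeriesOpenCellSection                         -- ★ B-p10 (L-ℓ) GENERIC-`N`
import Literature.NumberTheory.Automorphic.JacquetNonzeroEmbedsNormalizedInd                       -- ★ `deltaChar_cmBorelTriple_eq_one_of_mem_N`
import Literature.NumberTheory.Automorphic.UnitaryGroupUnipotentLimitCompactOpen                   -- ★ `isLimitOfCompactOpen_cmBorelTriple_N`
import HarnessLib

/-!
# The Jacquet filtration of the principal series of `U(Φ₂)(L⁺_v)` ([Casselman1995, Lemma 7.1.1 (a)] for the rank-one quasi-split unitary group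
# `U(1,1) = U(Φ₂)`, the `U(Φ₂)`-factor of `H = U(2) × U(1)`): `dim r_{B₂} i(χ) = 2`, a line on which `T₂` acts by `wχ`, quotient `χ`

Summit `HodgeConjecture`, sub-problem `HodgeConjecture`, crux H413 (`stmt-HodgeConjecture-24833`, lane `--supports … --as helper`); cell `hodgecm-mathlib`,
line LH6 «StCharTS», road (D) «DEEP-FL» slice (D-b)∕F1-H, brick W2-c (seat LH5-p05 (g2)).  THEOREMS ONLY; no definition, no instance, no notation, no named fact,
no `sorry`.  The `N = 2` twin of the ★ named fact N1 `U3PrincipalSeriesJacquetFiltration_holds` (B-p10∕A-p13∕A-p19), assembled from the SAME generic ★ pieces: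
closed cell ★ `evalJacquetKer` (A-p19), open-cell bound ★ `finrank_le_of_forall_mem_iff_exists_toFun_one_eq_zero_normalizedInd` (A-p19) over ★
`u2LocalBruhatDecomposition` + ★ `hasCompactSupport_cellFun_cmBorel_two`, lower bounds ★ `exists_cmPrincipalSeries_toFun_one_eq_zero_and_mk_ne_zero` (`2 ≤ N`) ∕ ★
`exists_cmPrincipalSeries_toFun_one_eq_one` ∕ ★ `exists_linearMap_coinvariants_cmPrincipalSeries` (B-p10), rank–nullity ★ `finrank_eq_two_of_closedCell_openCell`
(B-p10), and (γ-W)₂ ★ `torus_normalizedJacquet_openCellLine_eq_weylChar_two` (W2-b).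
HONEST LABEL: count-neutral; HC_CM is proved only modulo the 7 printed citations (2 remaining: hLiu418 = stmt-HodgeConjecture-24832, h413 =
stmt-HodgeConjecture-24833) until rung 0 closes.

* `u2PrincipalSeries_jacquetFiltration` — at a NON-SPLIT `v`, for CONTINUOUS `χ₁ : (∏_{w∣v} L_w)ˣ → ℂˣ`, `χ₂ : E¹_v → ℂˣ` and `χ = torusCharPair … 0 χ₁ χ₂`:
  `r_{B₂} i(χ)` (`i(χ) = cmPrincipalSeries L 2 v χ`) is finite-dimensional of dimension `2`, with a LINE `ℓ` on which `T₂(L⁺_v)` acts (normalised Jacquet action) by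
  `wχ = weylTorusCharPair … 0 χ₁ χ₂ = (χ̄₁⁻¹, χ₂)` and modulo which it acts by `χ`.

## References
* [Casselman1995] W. Casselman, *Introduction to the theory of admissible representations of `p`-adic reductive groups* (1995), Lemma 7.1.1 (a) p. 67, §6.3.
* [BernsteinZelevinsky1977] I. N. Bernstein, A. V. Zelevinsky, Ann. Sci. ÉNS 10 (1977), §2.12 Geometrical Lemma, Cor. 2.13 (c).
* [Rogawski1990] J. D. Rogawski, *Automorphic Representations of Unitary Groups in Three Variables* (1990), §12.1 p. 171 (`U(1,1) × U(1)`).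
-/

set_option autoImplicit false
set_option linter.dupNamespace false

noncomputable section

open Literature.NumberTheory.Automorphic Literature.NumberTheory.Automorphic.UnitaryGroup
open Summit.HodgeConjecture.HodgeConjecture.Cruxes.H413.F0P3U3PrincipalSeriesJacquetClosedCell
open Summit.HodgeConjecture.HodgeConjecture.Cruxes.H413.F0P3U3PrincipalSeriesJacquetFiltrationHolds
open _root_.NumberField _root_.IsDedekindDomain
open scoped MatrixGroups

-- the mandated namespace has the single-problem summit's repeated segment (`HodgeConjecture.HodgeConjecture`)
namespace Summit.HodgeConjecture.HodgeConjecture.Cruxes.H413.F0P3cU2PrincipalSeriesJacquetFiltration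

variable (L : Type) [Field L] [NumberField L] [IsCMField L]

set_option synthInstance.maxHeartbeats 400000 in  -- instance paths on the CM carrier `∏_{w ∣ v} L_w` (as ★ N1)
set_option maxHeartbeats 8000000 in  -- the `rfl`-bridges `cmPrincipalSeries L 2 v χ = normalizedInd (cmBorelTriple L 2 v) (𝟙 ⊗ χ)` of (C)₂∕(U)₂ (cf. ★ `finrank_le_one_cmPrincipalSeries`, 2 M each)
/-- **THE JACQUET FILTRATION OF `i(χ₁, χ₂)` ON `U(Φ₂)(L⁺_v)` AT A NON-SPLIT PLACE** ([Casselman1995] Lemma 7.1.1 (a) for `U(1,1)`): for continuous `χ₁, χ₂`,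
`r_{B₂} i(χ)` is finite-dimensional of dimension `2` and has a LINE `ℓ` on which `T₂(L⁺_v)` acts by `wχ = (χ̄₁⁻¹, χ₂)` (★ `weylTorusCharPair`) and modulo which
it acts by `χ` (★ `torusCharPair`, coordinate `0`).  Assembly of ★ (C)₂ (U)₂ (L-ℓ)₂ (L-q)₂ (γ-W)₂ by ★ `finrank_eq_two_of_closedCell_openCell` (module docstring).
[cite: Casselman1995, Lemma 7.1.1 (a) p. 67; §6.3] [cite: BernsteinZelevinsky1977, §2.12 Geometrical Lemma, Cor. 2.13 (c)] [cite: Rogawski1990, §12.1 p. 171] -/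
theorem u2PrincipalSeries_jacquetFiltration (v : HeightOneSpectrum (𝓞 ↥(maximalRealSubfield L)))
    (hns : ∀ w : PlacesOver L v, IsCMField.complexConj L • w.1 = w.1)
    (χ₁ : (LocalRing L v)ˣ →* ℂˣ) (χ₂ : ↥(normOneUnits (conjLocal L (IsCMField.complexConj L) v)) →* ℂˣ)
    (h₁ : Continuous fun x => ((χ₁ x : ℂˣ) : ℂ)) (h₂ : Continuous fun x => ((χ₂ x : ℂˣ) : ℂ)) :
    haveI := locallyCompactSpace_cmBorelU L 2 v
    FiniteDimensional ℂ ((cmBorelTriple L 2 v).restrict (cmPrincipalSeries L 2 v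
        (torusCharPair (conjLocal L (IsCMField.complexConj L) v) (cmLocalForm L 2 v) (cmLocalForm_eq_over L 2 v) 0 χ₁ χ₂))).Coinvariants ∧
    Module.finrank ℂ ((cmBorelTriple L 2 v).restrict (cmPrincipalSeries L 2 v
        (torusCharPair (conjLocal L (IsCMField.complexConj L) v) (cmLocalForm L 2 v) (cmLocalForm_eq_over L 2 v) 0 χ₁ χ₂))).Coinvariants = 2 ∧
    ∃ ℓ : Submodule ℂ ((cmBorelTriple L 2 v).restrict (cmPrincipalSeries L 2 v
        (torusCharPair (conjLocal L (IsCMField.complexConj L) v) (cmLocalForm L 2 v) (cmLocalForm_eq_over L 2 v) 0 χ₁ χ₂))).Coinvariants,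
      Module.finrank ℂ ↥ℓ = 1 ∧
      (∀ (m : ↥(cmBorelTriple L 2 v).M), ∀ x ∈ ℓ,
        (cmPrincipalSeries L 2 v (torusCharPair (conjLocal L (IsCMField.complexConj L) v) (cmLocalForm L 2 v) (cmLocalForm_eq_over L 2 v) 0 χ₁ χ₂)).normalizedJacquet
            (cmBorelTriple L 2 v) m x =
          ((weylTorusCharPair (conjLocal L (IsCMField.complexConj L) v) (cmLocalForm L 2 v) (cmLocalForm_eq_over L 2 v) 0 χ₁ χ₂ m : ℂˣ) : ℂ) • x) ∧
      (∀ (m : ↥(cmBorelTriple L 2 v).M) (x : ((cmBorelTriple L 2 v).restrict (cmPrincipalSeries L 2 v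
          (torusCharPair (conjLocal L (IsCMField.complexConj L) v) (cmLocalForm L 2 v) (cmLocalForm_eq_over L 2 v) 0 χ₁ χ₂))).Coinvariants),
        (cmPrincipalSeries L 2 v (torusCharPair (conjLocal L (IsCMField.complexConj L) v) (cmLocalForm L 2 v) (cmLocalForm_eq_over L 2 v) 0 χ₁ χ₂)).normalizedJacquet
            (cmBorelTriple L 2 v) m x -
          ((torusCharPair (conjLocal L (IsCMField.complexConj L) v) (cmLocalForm L 2 v) (cmLocalForm_eq_over L 2 v) 0 χ₁ χ₂ m : ℂˣ) : ℂ) • x ∈ ℓ) := by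
  haveI := locallyCompactSpace_cmBorelU L 2 v
  have hχc := continuous_torusCharPair_apply (conjLocal L (IsCMField.complexConj L) v) (cmLocalForm L 2 v) (cmLocalForm_eq_over L 2 v) 0 χ₁ χ₂ h₁ h₂
  -- (γ-W)₂, (L-ℓ)₂, (L-q)₂ — all in the `cmPrincipalSeries` spelling
  have hT := F0P3cU2PrincipalSeriesOpenCellTorusChar.torus_normalizedJacquet_openCellLine_eq_weylChar_two L v hns χ₁ χ₂ h₁ h₂
  have HD := exists_cmPrincipalSeries_toFun_one_eq_zero_and_mk_ne_zero L 2 v le_rfl _ hχc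
  have HL1 := exists_cmPrincipalSeries_toFun_one_eq_one L 2 v _ hχc
  have HL2 := exists_linearMap_coinvariants_cmPrincipalSeries L 2 v _ hχc
  -- Bruhat + (Supp)₂ for the open-cell bound
  have H0 := u2LocalBruhatDecomposition L v
  have H1 := H0 hns
  obtain ⟨w₀, hval, -, hBruhat, -⟩ := H1
  have hB : ∀ g : ↥(unitaryGroupOfForm (conjLocal L (IsCMField.complexConj L) v) (cmLocalForm L 2 v)),
      g ∈ (cmBorelTriple L 2 v).P ∨ ∃ p ∈ (cmBorelTriple L 2 v).P, ∃ n ∈ (cmBorelTriple L 2 v).N, g = p * w₀ * n := hBruhat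
  have hS : ∀ f : Representation.SmoothInd (cmBorelTriple L 2 v).P
      (Representation.twist
          (((Representation.trivial ℂ ↥(torusU (conjLocal L (IsCMField.complexConj L) v) (cmLocalForm L 2 v)) ℂ).twist
            (torusCharPair (conjLocal L (IsCMField.complexConj L) v) (cmLocalForm L 2 v) (cmLocalForm_eq_over L 2 v) 0 χ₁ χ₂)).comp (cmBorelTriple L 2 v).proj) (rootDeltaChar (cmBorelTriple L 2 v).P)),
      f.toFun 1 = 0 → HasCompactSupport fun n : ↥(cmBorelTriple L 2 v).N => f.toFun (w₀ * (n : ↥(unitaryGroupOfForm (conjLocal L (IsCMField.complexConj L) v) (cmLocalForm L 2 v)))) :=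
    fun f hf => F0P3bU2PrincipalSeriesJacquetRankLeTwo.hasCompactSupport_cellFun_cmBorel_two L v hns w₀ hval _ f hf
  have hN := isLimitOfCompactOpen_cmBorelTriple_N L 2 v
  have hδ := deltaChar_cmBorelTriple_eq_one_of_mem_N L 2 v
  -- (C)₂ the closed-cell kernel, transported to the `cmPrincipalSeries` spelling (`cmPrincipalSeries L 2 v χ = normalizedInd (cmBorelTriple L 2 v) (𝟙 ⊗ χ)`, `rfl`)
  have HC : ∃ ℓ : Submodule ℂ ((cmBorelTriple L 2 v).restrict (cmPrincipalSeries L 2 v (torusCharPair (conjLocal L (IsCMField.complexConj L) v) (cmLocalForm L 2 v) (cmLocalForm_eq_over L 2 v) 0 χ₁ χ₂))).Coinvariants,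
      (∀ (m : ↥(cmBorelTriple L 2 v).M), ∀ x ∈ ℓ, (cmPrincipalSeries L 2 v (torusCharPair (conjLocal L (IsCMField.complexConj L) v) (cmLocalForm L 2 v) (cmLocalForm_eq_over L 2 v) 0 χ₁ χ₂)).normalizedJacquet (cmBorelTriple L 2 v) m x ∈ ℓ) ∧
      (∀ (m : ↥(cmBorelTriple L 2 v).M) (x : ((cmBorelTriple L 2 v).restrict (cmPrincipalSeries L 2 v (torusCharPair (conjLocal L (IsCMField.complexConj L) v) (cmLocalForm L 2 v) (cmLocalForm_eq_over L 2 v) 0 χ₁ χ₂))).Coinvariants),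
        (cmPrincipalSeries L 2 v (torusCharPair (conjLocal L (IsCMField.complexConj L) v) (cmLocalForm L 2 v) (cmLocalForm_eq_over L 2 v) 0 χ₁ χ₂)).normalizedJacquet (cmBorelTriple L 2 v) m x - (((torusCharPair (conjLocal L (IsCMField.complexConj L) v) (cmLocalForm L 2 v) (cmLocalForm_eq_over L 2 v) 0 χ₁ χ₂) m : ℂˣ) : ℂ) • x ∈ ℓ) ∧
      FiniteDimensional ℂ (((cmBorelTriple L 2 v).restrict (cmPrincipalSeries L 2 v (torusCharPair (conjLocal L (IsCMField.complexConj L) v) (cmLocalForm L 2 v) (cmLocalForm_eq_over L 2 v) 0 χ₁ χ₂))).Coinvariants ⧸ ℓ) ∧ Module.finrank ℂ (((cmBorelTriple L 2 v).restrict (cmPrincipalSeries L 2 v (torusCharPair (conjLocal L (IsCMField.complexConj L) v) (cmLocalForm L 2 v) (cmLocalForm_eq_over L 2 v) 0 χ₁ χ₂))).Coinvariants ⧸ ℓ) ≤ 1 ∧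
      (∀ x, x ∈ ℓ ↔ ∃ f : Representation.SmoothInd (cmBorelTriple L 2 v).P
          (Representation.twist
          (((Representation.trivial ℂ ↥(torusU (conjLocal L (IsCMField.complexConj L) v) (cmLocalForm L 2 v)) ℂ).twist
            (torusCharPair (conjLocal L (IsCMField.complexConj L) v) (cmLocalForm L 2 v) (cmLocalForm_eq_over L 2 v) 0 χ₁ χ₂)).comp (cmBorelTriple L 2 v).proj) (rootDeltaChar (cmBorelTriple L 2 v).P)),
        f.toFun 1 = 0 ∧ Representation.Coinvariants.mk ((cmBorelTriple L 2 v).restrict (cmPrincipalSeries L 2 v (torusCharPair (conjLocal L (IsCMField.complexConj L) v) (cmLocalForm L 2 v) (cmLocalForm_eq_over L 2 v) 0 χ₁ χ₂))) f = x) :=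
    ⟨evalJacquetKer (cmBorelTriple L 2 v) ((Representation.trivial ℂ ↥(torusU (conjLocal L (IsCMField.complexConj L) v) (cmLocalForm L 2 v)) ℂ).twist (torusCharPair (conjLocal L (IsCMField.complexConj L) v) (cmLocalForm L 2 v) (cmLocalForm_eq_over L 2 v) 0 χ₁ χ₂)) hδ,
      fun m x hx => normalizedJacquet_mem_evalJacquetKer (cmBorelTriple L 2 v) ((Representation.trivial ℂ ↥(torusU (conjLocal L (IsCMField.complexConj L) v) (cmLocalForm L 2 v)) ℂ).twist (torusCharPair (conjLocal L (IsCMField.complexConj L) v) (cmLocalForm L 2 v) (cmLocalForm_eq_over L 2 v) 0 χ₁ χ₂)) hδ m hx,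
      fun m x => normalizedJacquet_sub_smul_mem_evalJacquetKer (cmBorelTriple L 2 v) ((Representation.trivial ℂ ↥(torusU (conjLocal L (IsCMField.complexConj L) v) (cmLocalForm L 2 v)) ℂ).twist (torusCharPair (conjLocal L (IsCMField.complexConj L) v) (cmLocalForm L 2 v) (cmLocalForm_eq_over L 2 v) 0 χ₁ χ₂)) hδ (torusCharPair (conjLocal L (IsCMField.complexConj L) v) (cmLocalForm L 2 v) (cmLocalForm_eq_over L 2 v) 0 χ₁ χ₂)
        (fun m w => by rw [Representation.twist_apply, Representation.trivial_apply]) m x,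
      finiteDimensional_quotient_evalJacquetKer (cmBorelTriple L 2 v) ((Representation.trivial ℂ ↥(torusU (conjLocal L (IsCMField.complexConj L) v) (cmLocalForm L 2 v)) ℂ).twist (torusCharPair (conjLocal L (IsCMField.complexConj L) v) (cmLocalForm L 2 v) (cmLocalForm_eq_over L 2 v) 0 χ₁ χ₂)) hδ,
      (finrank_quotient_evalJacquetKer_le (cmBorelTriple L 2 v) ((Representation.trivial ℂ ↥(torusU (conjLocal L (IsCMField.complexConj L) v) (cmLocalForm L 2 v)) ℂ).twist (torusCharPair (conjLocal L (IsCMField.complexConj L) v) (cmLocalForm L 2 v) (cmLocalForm_eq_over L 2 v) 0 χ₁ χ₂)) hδ).trans (Module.finrank_self ℂ).le,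
      fun x => mem_evalJacquetKer_iff (cmBorelTriple L 2 v) ((Representation.trivial ℂ ↥(torusU (conjLocal L (IsCMField.complexConj L) v) (cmLocalForm L 2 v)) ℂ).twist (torusCharPair (conjLocal L (IsCMField.complexConj L) v) (cmLocalForm L 2 v) (cmLocalForm_eq_over L 2 v) 0 χ₁ χ₂)) hδ x⟩
  -- (U)₂ the open-cell bound for every such `ℓ`
  have HU : ∀ ℓ : Submodule ℂ ((cmBorelTriple L 2 v).restrict (cmPrincipalSeries L 2 v (torusCharPair (conjLocal L (IsCMField.complexConj L) v) (cmLocalForm L 2 v) (cmLocalForm_eq_over L 2 v) 0 χ₁ χ₂))).Coinvariants,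
      (∀ x, x ∈ ℓ ↔ ∃ f : Representation.SmoothInd (cmBorelTriple L 2 v).P
          (Representation.twist
          (((Representation.trivial ℂ ↥(torusU (conjLocal L (IsCMField.complexConj L) v) (cmLocalForm L 2 v)) ℂ).twist
            (torusCharPair (conjLocal L (IsCMField.complexConj L) v) (cmLocalForm L 2 v) (cmLocalForm_eq_over L 2 v) 0 χ₁ χ₂)).comp (cmBorelTriple L 2 v).proj) (rootDeltaChar (cmBorelTriple L 2 v).P)),
        f.toFun 1 = 0 ∧ Representation.Coinvariants.mk ((cmBorelTriple L 2 v).restrict (cmPrincipalSeries L 2 v (torusCharPair (conjLocal L (IsCMField.complexConj L) v) (cmLocalForm L 2 v) (cmLocalForm_eq_over L 2 v) 0 χ₁ χ₂))) f = x) →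
      FiniteDimensional ℂ ↥ℓ ∧ Module.finrank ℂ ↥ℓ ≤ 1 := by
    intro ℓ hℓ
    have H := Representation.finrank_le_of_forall_mem_iff_exists_toFun_one_eq_zero_normalizedInd (cmBorelTriple L 2 v)
      ((Representation.trivial ℂ ↥(torusU (conjLocal L (IsCMField.complexConj L) v) (cmLocalForm L 2 v)) ℂ).twist (torusCharPair (conjLocal L (IsCMField.complexConj L) v) (cmLocalForm L 2 v) (cmLocalForm_eq_over L 2 v) 0 χ₁ χ₂)) w₀ hN hB hS ℓ hℓ
    obtain ⟨hfd, hle⟩ := H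
    refine ⟨hfd, ?_⟩
    have hle' : Module.finrank ℂ ↥ℓ ≤ Module.finrank ℂ ℂ := hle
    have h1 : Module.finrank ℂ ℂ = 1 := Module.finrank_self ℂ
    omega
  -- (γ-W)₂ on the classes of the sections vanishing at `1` (through the closed-cell `ℓ`)
  obtain ⟨ℓ₀, hst, hq, hfdq, hrkq, hℓ₀⟩ := HC
  have HU₀ := HU ℓ₀ hℓ₀
  have hW : ∀ (m : ↥(cmBorelTriple L 2 v).M) (f : Representation.SmoothInd (cmBorelTriple L 2 v).P
      (Representation.twist
          (((Representation.trivial ℂ ↥(torusU (conjLocal L (IsCMField.complexConj L) v) (cmLocalForm L 2 v)) ℂ).twist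
            (torusCharPair (conjLocal L (IsCMField.complexConj L) v) (cmLocalForm L 2 v) (cmLocalForm_eq_over L 2 v) 0 χ₁ χ₂)).comp (cmBorelTriple L 2 v).proj) (rootDeltaChar (cmBorelTriple L 2 v).P))),
      f.toFun 1 = 0 →
      (cmPrincipalSeries L 2 v (torusCharPair (conjLocal L (IsCMField.complexConj L) v) (cmLocalForm L 2 v) (cmLocalForm_eq_over L 2 v) 0 χ₁ χ₂)).normalizedJacquet (cmBorelTriple L 2 v) m
          (Representation.Coinvariants.mk ((cmBorelTriple L 2 v).restrict (cmPrincipalSeries L 2 v (torusCharPair (conjLocal L (IsCMField.complexConj L) v) (cmLocalForm L 2 v) (cmLocalForm_eq_over L 2 v) 0 χ₁ χ₂))) f) =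
        (((weylTorusCharPair (conjLocal L (IsCMField.complexConj L) v) (cmLocalForm L 2 v) (cmLocalForm_eq_over L 2 v) 0 χ₁ χ₂) m : ℂˣ) : ℂ) • Representation.Coinvariants.mk ((cmBorelTriple L 2 v).restrict (cmPrincipalSeries L 2 v (torusCharPair (conjLocal L (IsCMField.complexConj L) v) (cmLocalForm L 2 v) (cmLocalForm_eq_over L 2 v) 0 χ₁ χ₂))) f :=
    fun m f hf => hT ℓ₀ (fun x hx => (hℓ₀ x).1 hx) (fun g hg => (hℓ₀ _).2 ⟨g, hg, rfl⟩) HU₀.1 HU₀.2 m _ ((hℓ₀ _).2 ⟨f, hf, rfl⟩)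
  exact finrank_eq_two_of_closedCell_openCell ⟨ℓ₀, hst, hq, hfdq, hrkq, hℓ₀⟩ HU HD ⟨HL1, HL2⟩ hW

end Summit.HodgeConjecture.HodgeConjecture.Cruxes.H413.F0P3cU2PrincipalSeriesJacquetFiltration

end
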